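import Mathlib
import Literature.Analysis.FluidPDE.ClassicalSolution
import Literature.Analysis.FluidPDE.LerayHopf
import Literature.Analysis.FluidPDE.TaoLocalisation
import Summits.NavierStokesRegularity.NavierStokesRegularity.Theses.L3TimeExponentPincer
import Summits.NavierStokesRegularity.NavierStokesRegularity.Theorems.L3TimeExponentPincerSmoothBranch
import HarnessLib.Audit
import HarnessLib

/-!
# Stub `stub_jawSmoothBranch` of line `EffSat` (crux `L3CascadeJaw`, route `L3TimeExponentPincer`) — CLOSED

The registered M-stub of the skeleton `Lines/effsat.lean` of `stmt-NavierStokesRegularity-19499` (skeleton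
registered by `ledger skeleton check` 2026-08-26, stubs `stub_effSaturation_blowup`, `stub_jawSmoothBranch`),
proved BY NAME and with its registered signature: the jaw `∫_{T₂}^T ‖u(t)‖₃^q dt < ∞` (`4 < q < 5`) on the
SMOOTH branch (a frame solution that extends smoothly past `T`).  The content is the tree theorem
`Theorems.L3TimeExponentPincerSmoothBranch.jawSmoothBranch_holds` (p414110, cell ns-regularity-ideate seat p2:
Tao 2013 closed-slab bounds ⇒ `‖u(t)‖₃` bounded near `T`); after the split of the crux (route rev 2) the same
statement is the child item `…Theses.L3TimeExponentPincer.JawSmoothBranch` (`stmt-NavierStokesRegularity-19140`),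
recorded here as `stub_jawSmoothBranch_iff_item` (definitional).

WHAT THIS IS NOT: not a claim about Navier–Stokes regularity; the open content of the line is the other stub
(`stub_effSaturation_blowup` = item 19139 `EffSatBlowup`).
-/

noncomputable section

namespace Summit.NavierStokesRegularity.NavierStokesRegularity.Cruxes.L3CascadeJaw.EffSat

open MeasureTheory Set Metric
open scoped ENNReal
open Literature.Analysis.FluidPDE
open Summit.NavierStokesRegularity.NavierStokesRegularity.Theorems.L3TimeExponentPincerSmoothBranch

/-- **Registered stub `stub_jawSmoothBranch` (PROVED).**  A classical solution on `[0,T)`, Leray–Hopf from a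
rapidly decaying datum, that extends smoothly past `T` has `∫_{T₂}^T ‖u(t)‖₃^q dt < ∞` on some final window,
for every `q ∈ (4,5)`.  Proof: `jawSmoothBranch_holds`. -/
theorem stub_jawSmoothBranch :
    ∀ q : ℝ, 4 < q → q < 5 → ∀ (ν T : ℝ), 0 < ν → 0 < T → ∀ (u : ℝ → (EuclideanSpace ℝ (Fin 3)) → (EuclideanSpace ℝ (Fin 3))) (p : ℝ → (EuclideanSpace ℝ (Fin 3)) → ℝ),
      IsClassicalNSSolutionOn (Ico 0 T) ν 0 u p → IsLerayHopfOn T ν 0 (u 0) u →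
      HasRapidSpatialDecay (u 0) → HasSmoothExtensionPast ν 0 u T →
      ∃ T₂ ∈ Ioo 0 T, (∫⁻ t in Ioo T₂ T, eLpNorm (u t) 3 volume ^ q) < ⊤ :=
  jawSmoothBranch_holds

/-- The stub statement IS the child item `JawSmoothBranch` of the split (stmt-NavierStokesRegularity-19140),
definitionally. -/
theorem stub_jawSmoothBranch_iff_item :
    (∀ q : ℝ, 4 < q → q < 5 → ∀ (ν T : ℝ), 0 < ν → 0 < T → ∀ (u : ℝ → (EuclideanSpace ℝ (Fin 3)) → (EuclideanSpace ℝ (Fin 3))) (p : ℝ → (EuclideanSpace ℝ (Fin 3)) → ℝ),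
      IsClassicalNSSolutionOn (Ico 0 T) ν 0 u p → IsLerayHopfOn T ν 0 (u 0) u →
      HasRapidSpatialDecay (u 0) → HasSmoothExtensionPast ν 0 u T →
      ∃ T₂ ∈ Ioo 0 T, (∫⁻ t in Ioo T₂ T, eLpNorm (u t) 3 volume ^ q) < ⊤) ↔
    Summit.NavierStokesRegularity.NavierStokesRegularity.Theses.L3TimeExponentPincer.JawSmoothBranch :=
  Iff.rfl

end Summit.NavierStokesRegularity.NavierStokesRegularity.Cruxes.L3CascadeJaw.EffSat

end
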